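import Mathlib.LinearAlgebra.Eigenspace.Triangularizable
import Mathlib.LinearAlgebra.Eigenspace.Zero
import Mathlib.LinearAlgebra.Charpoly.ToMatrix
import Mathlib.LinearAlgebra.Matrix.Notation
import Mathlib.Tactic.FinCases
import HarnessLib

/-!
# Generic gap kills monodromy

Helper file for the crux `GaloisRepOfRegularAlgebraic` (stmt-Langlands-10785, line `Sketch`) of
the route `IrreducibilityBySelfDuality`: the linear-algebra core `stub_monodromyGap`.

In the Weil–Deligne representation attached to an `ℓ`-adic Galois representation at a place `v`,
a Frobenius `Φ` and the monodromy operator `N` satisfy `Φ N Φ⁻¹ = q N`, i.e. `Φ N = q N Φ`.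
**If no two eigenvalues of `Φ` are in ratio `q`, then `N = 0`.**

Proof.  From `Φ N = q N Φ` one gets `(Φ - qμ) N = q · N (Φ - μ)`, hence
`(Φ - qμ)^m N = q^m · N (Φ - μ)^m` for all `m`; so `N` maps the generalised `μ`-eigenspace of
`Φ` into the generalised `qμ`-eigenspace.  A generalised eigenspace is non-zero exactly when its
parameter is a root of the characteristic polynomial (`LinearMap.finrank_maxGenEigenspace_eq`), so
by the gap hypothesis `N` kills every generalised eigenspace of `Φ`; over an algebraically closed
field these span (`Module.End.iSup_maxGenEigenspace_eq_top`), whence `N = 0`.  No nilpotency of `N`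
and no invertibility of `Φ` or `q` is needed.  The `example` at the end records that the gap
hypothesis is sharp (`Φ = diag(q, 1)`, `N = E₁₂`).

Mathlib only.
-/

set_option linter.dupNamespace false -- project-wide option (lakefile weak.linter.dupNamespace); `Summit.Langlands.Langlands` is the mandated namespace

open Polynomial

namespace Summit.Langlands.Langlands.Theorems.GaloisRepOfRegularAlgebraic

/-- **Generic gap kills monodromy.**  Over an algebraically closed field `k`, if square matrices
`Φ`, `N` and a scalar `q` satisfy `Φ N = q • (N Φ)` and no two roots `a`, `b` of the characteristic
polynomial of `Φ` satisfy `a = q b`, then `N = 0`: `N` maps the generalised `μ`-eigenspace of `Φ`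
into the generalised `qμ`-eigenspace, at most one of which is non-zero, and the generalised
eigenspaces span. [folklore] -/
theorem stub_monodromyGap :
    ∀ {k : Type} [Field k] [IsAlgClosed k] {n : ℕ} (Φ N : Matrix (Fin n) (Fin n) k) (q : k),
      Φ * N = q • (N * Φ) →
      (∀ a ∈ Φ.charpoly.roots, ∀ b ∈ Φ.charpoly.roots, a ≠ q * b) → N = 0 := by
  intro k _ _ n Φ N q hΦN hgap
  classical
  -- pass to endomorphisms of `Fin n → k`
  set f : Module.End k (Fin n → k) := Matrix.toLin' Φ with hf
  set g : Module.End k (Fin n → k) := Matrix.toLin' N with hg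
  have hfg : f * g = q • (g * f) := by
    rw [hf, hg, Module.End.mul_eq_comp, Module.End.mul_eq_comp, ← Matrix.toLin'_mul,
      ← Matrix.toLin'_mul, hΦN, map_smul]
  have hchar : f.charpoly = Φ.charpoly := Matrix.charpoly_toLin' Φ
  -- a generalised eigenspace of `f` is non-zero only at roots of the characteristic polynomial
  have hroot : ∀ μ : k, f.maxGenEigenspace μ ≠ ⊥ → μ ∈ Φ.charpoly.roots := by
    intro μ hμ
    rwa [ne_eq, ← Submodule.finrank_eq_zero, LinearMap.finrank_maxGenEigenspace_eq, hchar,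
      ← count_roots, Multiset.count_eq_zero, not_not] at hμ
  -- the commutation rule `(f - qμ) g = q • g (f - μ)` and its powers
  have hbase : ∀ μ : k, (f - (q * μ) • (1 : Module.End k (Fin n → k))) * g =
      q • (g * (f - μ • (1 : Module.End k (Fin n → k)))) := by
    intro μ
    rw [sub_mul, smul_one_mul, mul_sub, mul_smul_one, smul_sub, smul_smul, hfg]
  have hcomm : ∀ (μ : k) (m : ℕ), (f - (q * μ) • (1 : Module.End k (Fin n → k))) ^ m * g =
      q ^ m • (g * (f - μ • (1 : Module.End k (Fin n → k))) ^ m) := by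
    intro μ m
    induction m with
    | zero => simp
    | succ m ih =>
      rw [pow_succ', mul_assoc, ih, mul_smul_comm, ← mul_assoc, hbase, smul_mul_assoc, smul_smul,
        ← pow_succ, mul_assoc, ← pow_succ']
  -- `g` maps the generalised `μ`-eigenspace into the generalised `qμ`-eigenspace
  have hmaps : ∀ μ : k, ∀ v ∈ f.maxGenEigenspace μ, g v ∈ f.maxGenEigenspace (q * μ) := by
    intro μ v hv
    rw [Module.End.mem_maxGenEigenspace] at hv ⊢
    obtain ⟨m, hm⟩ := hv
    refine ⟨m, ?_⟩
    have h := LinearMap.congr_fun (hcomm μ m) v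
    rw [Module.End.mul_apply, LinearMap.smul_apply, Module.End.mul_apply, hm, map_zero,
      smul_zero] at h
    exact h
  -- hence, by the gap hypothesis, `g` kills every generalised eigenspace
  have hkill : ∀ μ : k, ∀ v ∈ f.maxGenEigenspace μ, g v = 0 := by
    intro μ v hv
    by_contra hgv
    have h1 : f.maxGenEigenspace (q * μ) ≠ ⊥ := by
      intro hbot
      have hv' := hmaps μ v hv
      rw [hbot, Submodule.mem_bot] at hv'
      exact hgv hv'
    have h2 : f.maxGenEigenspace μ ≠ ⊥ := by
      intro hbot
      rw [hbot, Submodule.mem_bot] at hv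
      rw [hv, map_zero] at hgv
      exact hgv rfl
    exact hgap _ (hroot _ h1) _ (hroot _ h2) rfl
  -- the generalised eigenspaces span, so `g = 0`
  have hg0 : g = 0 := by
    refine LinearMap.ext fun v => ?_
    have hv : v ∈ ⨆ μ : k, f.maxGenEigenspace μ := by
      rw [Module.End.iSup_maxGenEigenspace_eq_top]
      exact Submodule.mem_top
    rw [LinearMap.zero_apply]
    refine Submodule.iSup_induction _ (motive := fun x => g x = 0) hv hkill (map_zero g) ?_
    intro x y hx hy
    rw [map_add, hx, hy, add_zero]
  -- back to matrices
  have h0 : Matrix.toLin' N = Matrix.toLin' (0 : Matrix (Fin n) (Fin n) k) := by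
    rw [map_zero]
    exact hg0
  exact Matrix.toLin'.injective h0

/-- Sharpness of the gap hypothesis: `Φ = diag(q, 1)` and `N = E₁₂ ≠ 0` satisfy `Φ N = q • (N Φ)`
(here the roots `q`, `1` of the characteristic polynomial of `Φ` ARE in ratio `q`). -/
example {k : Type} [Field k] (q : k) :
    !![q, 0; 0, 1] * !![0, 1; 0, 0] = q • (!![0, 1; 0, 0] * !![q, 0; 0, 1]) ∧
      (!![0, 1; 0, 0] : Matrix (Fin 2) (Fin 2) k) ≠ 0 := by
  refine ⟨?_, fun h => ?_⟩
  · ext i j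
    fin_cases i <;> fin_cases j <;> simp [Matrix.mul_apply, Fin.sum_univ_two]
  · have h01 := congrFun (congrFun h 0) 1
    simp at h01

end Summit.Langlands.Langlands.Theorems.GaloisRepOfRegularAlgebraic
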